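import Literature.NumberTheory.LFunctions.StarkNoQuadraticSubfieldGlue
import Mathlib.FieldTheory.Normal.Closure
import Mathlib.FieldTheory.Galois.Basic
import Mathlib.Algebra.Group.End
import Mathlib.GroupTheory.Perm.Fin
import HarnessLib

/-!
# The embedded `S₄`-closure of a quartic field: `Gal(N/ℚ) ≃ S₄` with `Gal(N/K) = Stab(0)`, `|d_N| ≤ |d_K|^24`

Topic `Summits/QuantumAdvantage/QuantumAdvantage/Theorems`, cell B2b-1 (linnik-cubic), PART A (gen 8);
helper toward the crux `DegreeOnePrimesEscape` (stmt-QuantumAdvantage-11543) of route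
`LinnikCubicClassGroups`.  HONEST FRAMING: the value of this file is a THEOREM (kernel-checked field
theory) — NOT summit progress.

An "`S₄`-quartic field" is a quartic number field `K` whose Galois closure has degree `24`; we phrase
this WITHOUT naming a closure: every Galois number field into which `K` embeds has degree `≥ 24`
(the normal closure always has degree `≤ 4! = 24`).  For such `K` the normal closure `N` of `K` in `ℚ̄`
is a Galois number field of degree `24`; `G = Gal(N/ℚ)` acts faithfully on the four embeddings
`K → N` (the embedded copies of `K` separate `G`, `exists_not_mem_fixingSubgroup_fieldRange`), which
gives an isomorphism `ψ : G ≃* Perm (Fin 4)` under which `Gal(N/K')`, `K' = f₀(K)`, is the stabiliser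
of `0`; and `|d_N| ≤ |d_K|^{[N:ℚ]} = |d_K|^{24}` (`natAbs_discr_le_pow_of_separating`).  Pattern and
instance realignment (`Subsingleton (Algebra ℚ N)`) as in `…CubicClosure.lean`.
-/

noncomputable section

open scoped NumberField
open Literature.NumberTheory.LFunctions Literature.NumberTheory.LFunctions.NumberField

namespace Summit.QuantumAdvantage.QuantumAdvantage.Theorems.DegreeOnePrimesEscape

/-- Transport of `Algebra.IsAlgebraic` along an equality of algebra structures. -/
private theorem isAlgebraic_of_algebra_eq' {F L : Type*} [Field F] [Field L] {A : Algebra F L}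
    (B : Algebra F L) (h : A = B) (hA : @Algebra.IsAlgebraic F L _ _ A) :
    @Algebra.IsAlgebraic F L _ _ B := by
  subst h; exact hA

/-- The normal closure of a finite extension `K/F` of a perfect field inside a normal `L/F` is
Galois over `F`. -/
private theorem isGalois_normalClosure_of_perfectField' (F K L : Type*) [Field F] [Field K]
    [Field L] [Algebra F K] [Algebra F L] [FiniteDimensional F K] [Normal F L] [PerfectField F] :
    IsGalois F (IntermediateField.normalClosure F K L) where

/-- `m! ≤ 6` for `m ≤ 3`. -/
private theorem factorial_le_six_of_le_three {m : ℕ} (hm : m ≤ 3) : m.factorial ≤ 6 := by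
  interval_cases m <;> decide

/-- **Abstract step.** Let `K` be a quartic number field all of whose Galois splitting fields have
degree `≥ 24`, and `M/ℚ` a finite Galois extension with `#Gal(M/ℚ) ≤ 24` in which the embedded copies
of `K` separate the Galois group, with one embedding `f₀ : K → M`.  Then `M` is a Galois number field of
degree `24`, `Gal(M/ℚ) ≃ S₄` with `Gal(M/f₀K)` the stabiliser of a point, and `|d_M| ≤ |d_K|^{24}`. -/
private theorem quarticClosure_of_inputs (K : Type) [Field K] [NumberField K]
    (h4 : Module.finrank ℚ K = 4)
    (hS4 : ∀ (M' : Type) [Field M'] [NumberField M'] [IsGalois ℚ M'],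
      (K →ₐ[ℚ] M') → 24 ≤ Module.finrank ℚ M')
    (M : Type) [Field M] {alg : Algebra ℚ M} (hfin : FiniteDimensional ℚ M) (hG : IsGalois ℚ M)
    (hcard : Nat.card (M ≃ₐ[ℚ] M) ≤ 24)
    (hsep : ∀ s : M ≃ₐ[ℚ] M, s ≠ 1 → ∃ f : K →ₐ[ℚ] M, s ∉ f.fieldRange.fixingSubgroup)
    (f₀ : K →ₐ[ℚ] M) :
    ∃ (N : Type) (_ : Field N) (_ : NumberField N), IsGalois ℚ N ∧ Module.finrank ℚ N = 24 ∧
      ∃ (K' : IntermediateField ℚ N) (_ : K ≃ₐ[ℚ] K') (ψ : (N ≃ₐ[ℚ] N) ≃* Equiv.Perm (Fin 4)),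
        (∀ g : N ≃ₐ[ℚ] N, g ∈ K'.fixingSubgroup ↔ ψ g 0 = 0) ∧
        (NumberField.discr N).natAbs ≤ (NumberField.discr K).natAbs ^ 24 := by
  classical
  have hcz : CharZero M := charZero_of_injective_algebraMap (algebraMap ℚ M).injective
  obtain rfl : alg = DivisionRing.toRatAlgebra := Subsingleton.elim _ _
  haveI hNF : NumberField M := @NumberField.mk M _ hcz hfin
  -- the degree is `24`
  have hGal : Nat.card (M ≃ₐ[ℚ] M) = Module.finrank ℚ M := IsGalois.card_aut_eq_finrank ℚ M
  have h24 : Module.finrank ℚ M = 24 := le_antisymm (hGal ▸ hcard) (hS4 M f₀)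
  have hG24 : Nat.card (M ≃ₐ[ℚ] M) = 24 := hGal.trans h24
  -- the action of `G` on the embeddings `K → M`
  let ψ₀ : (M ≃ₐ[ℚ] M) →* Equiv.Perm (K →ₐ[ℚ] M) :=
    { toFun := fun s => ⟨fun f => s.toAlgHom.comp f, fun f => s.symm.toAlgHom.comp f,
        fun f => by ext x; simp, fun f => by ext x; simp⟩
      map_one' := by ext f x; rfl
      map_mul' := fun s t => by ext f x; rfl }
  have hψ₀ : ∀ (s : M ≃ₐ[ℚ] M) (f : K →ₐ[ℚ] M) (x : K), ψ₀ s f x = s (f x) := fun s f x => rfl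
  have hinj : Function.Injective ψ₀ := by
    intro s t hst
    by_contra hne
    have hne1 : t⁻¹ * s ≠ 1 := fun h1 => hne (by
      have h2 := congrArg (t * ·) h1
      simpa using h2)
    obtain ⟨f, hf⟩ := hsep _ hne1
    apply hf
    rw [IntermediateField.mem_fixingSubgroup_iff]
    rintro _ ⟨x, rfl⟩
    have hx : s (f x) = t (f x) := by
      rw [← hψ₀ s f x, ← hψ₀ t f x, hst]
    show (t⁻¹ * s) (f x) = f x
    rw [AlgEquiv.mul_apply, hx, AlgEquiv.aut_inv, AlgEquiv.symm_apply_apply]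
  -- there are exactly `4` embeddings and `ψ₀` is bijective
  have hEmb_le : Fintype.card (K →ₐ[ℚ] M) ≤ 4 := by
    rw [← Nat.card_eq_fintype_card, ← h4]; exact card_algHom_le_finrank ℚ K M
  have hPerm : Nat.card (M ≃ₐ[ℚ] M) ≤ Nat.card (Equiv.Perm (K →ₐ[ℚ] M)) :=
    Nat.card_le_card_of_injective ψ₀ hinj
  rw [hG24, Nat.card_eq_fintype_card, Fintype.card_perm] at hPerm
  have hEmb : Fintype.card (K →ₐ[ℚ] M) = 4 := by
    by_contra hne
    have hle3 : Fintype.card (K →ₐ[ℚ] M) ≤ 3 := by omega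
    have := factorial_le_six_of_le_three hle3
    omega
  have hbij : Function.Bijective ψ₀ := hinj.bijective_of_nat_card_le (by
    rw [hG24, Nat.card_eq_fintype_card, Fintype.card_perm, hEmb]; decide)
  -- number the embeddings with `f₀ ↦ 0`
  let e₁ : (K →ₐ[ℚ] M) ≃ Fin 4 := Fintype.equivFinOfCardEq hEmb
  let e : (K →ₐ[ℚ] M) ≃ Fin 4 := e₁.trans (Equiv.swap (e₁ f₀) 0)
  have he : e f₀ = 0 := by simp [e, Equiv.swap_apply_left]
  let ψ : (M ≃ₐ[ℚ] M) ≃* Equiv.Perm (Fin 4) := (MulEquiv.ofBijective ψ₀ hbij).trans e.permCongrHom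
  have hstab : ∀ g : M ≃ₐ[ℚ] M, g ∈ f₀.fieldRange.fixingSubgroup ↔ ψ g 0 = 0 := by
    intro g
    have h1 : ψ g 0 = e (ψ₀ g (e.symm 0)) := rfl
    have h2 : e.symm 0 = f₀ := by rw [← he, Equiv.symm_apply_apply]
    rw [h1, h2, ← he, e.apply_eq_iff_eq, IntermediateField.mem_fixingSubgroup_iff]
    constructor
    · intro h
      ext x
      rw [hψ₀]
      exact h _ ⟨x, rfl⟩
    · intro h
      rintro _ ⟨x, rfl⟩
      have h3 : ψ₀ g f₀ x = f₀ x := congrArg (fun φ : K →ₐ[ℚ] M => φ x) h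
      rw [hψ₀] at h3
      exact h3
  -- the discriminant bound
  have hdisc : (NumberField.discr M).natAbs ≤ (NumberField.discr K).natAbs ^ 24 :=
    h24 ▸ natAbs_discr_le_pow_of_separating K M hsep
  exact ⟨M, inferInstance, hNF, hG, h24, f₀.fieldRange, f₀.equivFieldRange, ψ, hstab, hdisc⟩

/-- **The embedded `S₄`-closure of an `S₄`-quartic field.** Let `K` be a quartic number field such
that every Galois number field into which `K` embeds has degree `≥ 24` (i.e. the Galois closure of
`K` has group `S₄`).  Then there is a Galois number field `N` of degree `24` containing a copy `K'` of
`K`, with an isomorphism `ψ : Gal(N/ℚ) ≃* S₄ = Perm (Fin 4)` under which `Gal(N/K')` is the stabiliser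
of `0`, and `|d_N| ≤ |d_K|^{24}`.  (`N` is the normal closure of `K` in `ℚ̄`.) -/
theorem quarticS4Closure (K : Type) [Field K] [NumberField K] (h4 : Module.finrank ℚ K = 4)
    (hS4 : ∀ (M : Type) [Field M] [NumberField M] [IsGalois ℚ M],
      (K →ₐ[ℚ] M) → 24 ≤ Module.finrank ℚ M) :
    ∃ (N : Type) (_ : Field N) (_ : NumberField N), IsGalois ℚ N ∧ Module.finrank ℚ N = 24 ∧
      ∃ (K' : IntermediateField ℚ N) (_ : K ≃ₐ[ℚ] K') (ψ : (N ≃ₐ[ℚ] N) ≃* Equiv.Perm (Fin 4)),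
        (∀ g : N ≃ₐ[ℚ] N, g ∈ K'.fixingSubgroup ↔ ψ g 0 = 0) ∧
        (NumberField.discr N).natAbs ≤ (NumberField.discr K).natAbs ^ 24 := by
  -- `ℚ̄` is an algebraic closure of `ℚ` also for the canonical `ℚ`-algebra structure
  haveI : IsAlgClosure ℚ (AlgebraicClosure ℚ) :=
    ⟨inferInstance, isAlgebraic_of_algebra_eq' _ (Subsingleton.elim _ _)
      (AlgebraicClosure.isAlgebraic ℚ)⟩
  have hcard := card_algEquiv_normalClosure_le_factorial ℚ K (AlgebraicClosure ℚ)
  rw [← Nat.card_eq_fintype_card, h4] at hcard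
  exact quarticClosure_of_inputs K h4 hS4 (IntermediateField.normalClosure ℚ K (AlgebraicClosure ℚ))
    (normalClosure.is_finiteDimensional ℚ K (AlgebraicClosure ℚ))
    (isGalois_normalClosure_of_perfectField' ℚ K (AlgebraicClosure ℚ))
    (hcard.trans (by decide))
    (fun _ hs => exists_not_mem_fixingSubgroup_fieldRange ℚ K (AlgebraicClosure ℚ) hs)
    ((normalClosure.algHomEquiv ℚ K (AlgebraicClosure ℚ)).symm IsAlgClosed.lift)


end Summit.QuantumAdvantage.QuantumAdvantage.Theorems.DegreeOnePrimesEscape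

end
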